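import Summits.Ventures.CertifiedManyBodySolver.Theorems.CovHg1201M19bKinematicPartsTp
import Summits.Ventures.CertifiedManyBodySolver.Downfold.BoxesHg1201EFineCut
import HarnessLib

/-!
# Theorems/CovHg1201M19bFineParts.lean — route «CovHg1201M19b» (hubbard-cov-hg1201-1): after «FINE-KINCUT» the certificate part of BOTH cruxes is the
# FINE TRIANGLE `{σ ∈ [−27/50, −1073/2000], n ∈ [181/200, 183/200], n ≥ 181/200 + (20/7)(σ + 27/50)}` — `7/40` of the g3 triangle, `≈` the exact kinematic residual

Supports stmt-Ventures-26187 «PatchBottom» (and stmt-Ventures-26186 «PatchLeftEdge»). Ingredients: hubbard-cov-hg1201-box-2 g1's outer-strip reductions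
(`Theorems/CovHg1201M19bKinematicPartsTp.lean`, p628941: item ⇐ item on `σ ∈ [−27/50, −53/100] × n ∈ [179/200, 183/200]`) and this seat's state-free words OUTSIDE THE
FINE TRIANGLE (`Downfold/BoxesHg1201EFineCut.lean`: chord A between the second-order corners `(−27/50, 181/200)` and `(−1073/2000, 183/200)`, chord B on the gap slab
`σ ∈ [−1073/2000, −53/100]`; rows `B(−27/50, 3806/8192) ≤ 0.3063397586`, `B(−1073/2000, 3785/8192) ≤ 0.3052806287` from the second-order kernel majorant
`Literature/…/HalfBathtubTrapezoidBound.lean`).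
* `covHg1201M19b_PatchBottom_of_fineTriangle` / `covHg1201M19b_PatchLeftEdge_of_fineTriangle`: (item restricted to the FINE TRIANGLE) → item.
* `covHg1201M19b_cruxes_of_fineTriangles`: both at once.
HONEST FRAMING: set algebra + one-body kinematics + the torus-limit variational inequality; zero solve, no claim node, no definition; CONDITIONAL on the fine triangle, where
the K1/K2 certificates (pinned pairs / WN reads, captain hubbard-cov-hg1201-plan-1) are still owed; certified stiffness-scale CEILINGS on a downfolded screening-grade box =
CONTROL / CALIBRATION + labelled heuristic (xx1; content = below `0.98 ×` the kinematic MAJORANT, no suppression below free claimed); a ceiling never speaks to the presence of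
superconductivity; not a `T_c`, phase or pressure sentence; NO item, stub or rung leaf is closed by this file; NOT a cut of record (the captain's call); no summit statement is
proved. Seat hubbard-cov-hg1201-unc-2 g4 (`prover-hubbard-cov-hg1201-unc-2-g3-0`), cell `pub/hubbard-downfold`.
-/

noncomputable section

namespace Summit.Ventures.CertifiedManyBodySolver.Theorems

open Set Filter Topology
open Summit.Ventures.CertifiedManyBodySolver.Theses.CovHg1201M19b
open Summit.Ventures.CertifiedManyBodySolver.Observables
open Summit.Ventures.CertifiedManyBodySolver.Downfold
open Summit.Ventures.CertifiedManyBodySolver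
open Literature.MathematicalPhysics.QuantumLattice Literature.MathematicalPhysics.QuantumLattice.ThermodynamicLimit
open Literature.Probability.LatticeModels
open Matrix HubbardWave0
open scoped BigOperators ComplexOrder

/-- **«PatchBottom» (stmt-Ventures-26187) from its FINE TRIANGLE**: the item restricted to slots `σ ∈ [−27/50, −1073/2000]` (sources `s ∈ [−27/50, σ]`) and densities
`n ∈ [181/200, 183/200]` with `n ≥ 181/200 + (20/7)(σ + 27/50)` implies the item — densities `≤ 179/200` (box-2 g0), slots `≥ −53/100` (TP-KINCUT), the gap slab
`σ ≥ −1073/2000` (chord B) and the trapezoid under chord A are state-free. CONDITIONAL on the fine triangle. [cite: ScalapinoWhiteZhang1993, §II] [cite: LiebLoss1993, §8, Theorem 8.2] -/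
theorem covHg1201M19b_PatchBottom_of_fineTriangle
    (h : ∀ n ∈ Set.Icc (181 / 200 : ℝ) (183 / 200), ∀ σ ∈ Set.Icc (-27 / 50 : ℝ) (-1073 / 2000), 181 / 200 + 20 / 7 * (σ + 27 / 50) ≤ n →
      ∀ s ∈ Set.Icc (-27 / 50 : ℝ) σ,
      ∀ (ω : InfVolFermionState 2) (Ls : ℕ → ℕ) (ψ : ∀ L, Fock (Orb (FermionTorus 2 L))),
      Tendsto Ls atTop atTop →
      (∀ j, IsGroundStateInSector (hubbardTorusTT' (Ls j) 1 s (7 / 2)) (rectN n (Ls j)) 0 (ψ (Ls j))) →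
      (∀ j, star (ψ (Ls j)) ⬝ᵥ ψ (Ls j) = 1) → ω.IsTorusLimitOf ψ Ls →
      -(5166800 / 10000000 : ℝ) ≤ ((Finset.univ : Finset (DihedralGroup 4)).card : ℝ)⁻¹ * ∑ g ∈ (Finset.univ : Finset (DihedralGroup 4)),
        (ω.expect (d4ShiftSet g 0 (Literature.Probability.LatticeModels.box 2 7))
          (fermionEmbed (PolySite.d4Emb g 0 (Literature.Probability.LatticeModels.box 2 7)) (-oddMomentObsTT σ (7 / 2) 0))).re) :
    PatchBottom := by
  refine covHg1201M19b_PatchBottom_of_outerStrip (fun n hn σ hσ s hs ω Ls ψ hLs hψ h1 hω => ?_)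
  by_cases hin : σ ≤ -1073 / 2000 ∧ 181 / 200 + 20 / 7 * (σ + 27 / 50) ≤ n
  · exact h n ⟨by linarith [hin.2, hσ.1], hn.2⟩ σ ⟨hσ.1, hin.1⟩ hin.2 s hs ω Ls ψ hLs hψ h1 hω
  · have hout : -1073 / 2000 ≤ σ ∨ n ≤ 181 / 200 + 20 / 7 * (σ + 27 / 50) := by
      rcases not_and_or.1 hin with h' | h'
      · exact Or.inl (not_le.1 h').le
      · exact Or.inr (not_le.1 h').le
    exact hg1201M19b_slot_orbitMean_ge_negBar_outside_fineTriangle σ (7 / 2) s (7 / 2) hσ (by linarith [hn.1]) hn.2 hout ω Ls ψ hLs hψ h1 hω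

/-- **«PatchLeftEdge» (stmt-Ventures-26186) from its FINE TRIANGLE**: the item restricted to `σ ∈ [−27/50, −1073/2000]`, `n ∈ [181/200, 183/200]`,
`n ≥ 181/200 + (20/7)(σ + 27/50)` (states at `(−27/50, U′, n)`, `U′ ∈ [7/2, 44/5]`) implies the item. CONDITIONAL on the fine triangle.
[cite: ScalapinoWhiteZhang1993, §II] [cite: LiebLoss1993, §8, Theorem 8.2] -/
theorem covHg1201M19b_PatchLeftEdge_of_fineTriangle
    (h : ∀ n ∈ Set.Icc (181 / 200 : ℝ) (183 / 200), ∀ σ ∈ Set.Icc (-27 / 50 : ℝ) (-1073 / 2000), 181 / 200 + 20 / 7 * (σ + 27 / 50) ≤ n →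
      ∀ U' ∈ Set.Icc (7 / 2 : ℝ) (44 / 5),
      ∀ (ω : InfVolFermionState 2) (Ls : ℕ → ℕ) (ψ : ∀ L, Fock (Orb (FermionTorus 2 L))),
      Tendsto Ls atTop atTop →
      (∀ j, IsGroundStateInSector (hubbardTorusTT' (Ls j) 1 (-27 / 50) U') (rectN n (Ls j)) 0 (ψ (Ls j))) →
      (∀ j, star (ψ (Ls j)) ⬝ᵥ ψ (Ls j) = 1) → ω.IsTorusLimitOf ψ Ls →
      -(5166800 / 10000000 : ℝ) ≤ ((Finset.univ : Finset (DihedralGroup 4)).card : ℝ)⁻¹ * ∑ g ∈ (Finset.univ : Finset (DihedralGroup 4)),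
        (ω.expect (d4ShiftSet g 0 (Literature.Probability.LatticeModels.box 2 7))
          (fermionEmbed (PolySite.d4Emb g 0 (Literature.Probability.LatticeModels.box 2 7)) (-oddMomentObsTT σ U' 0))).re) :
    PatchLeftEdge := by
  refine covHg1201M19b_PatchLeftEdge_of_outerStrip (fun n hn σ hσ U' hU' ω Ls ψ hLs hψ h1 hω => ?_)
  by_cases hin : σ ≤ -1073 / 2000 ∧ 181 / 200 + 20 / 7 * (σ + 27 / 50) ≤ n
  · exact h n ⟨by linarith [hin.2, hσ.1], hn.2⟩ σ ⟨hσ.1, hin.1⟩ hin.2 U' hU' ω Ls ψ hLs hψ h1 hω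
  · have hout : -1073 / 2000 ≤ σ ∨ n ≤ 181 / 200 + 20 / 7 * (σ + 27 / 50) := by
      rcases not_and_or.1 hin with h' | h'
      · exact Or.inl (not_le.1 h').le
      · exact Or.inr (not_le.1 h').le
    exact hg1201M19b_slot_orbitMean_ge_negBar_outside_fineTriangle σ U' (-27 / 50) U' hσ (by linarith [hn.1]) hn.2 hout ω Ls ψ hLs hψ h1 hω

/-- **Both cruxes of «CovHg1201M19b» from their FINE TRIANGLES at once** (the bundle pair the K1/K2 programme still owes, now on `7/400000` of the `(σ, n)` plane each,
`7/3520` of the box face). [cite: ScalapinoWhiteZhang1993, §II] -/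
theorem covHg1201M19b_cruxes_of_fineTriangles
    (hB : ∀ n ∈ Set.Icc (181 / 200 : ℝ) (183 / 200), ∀ σ ∈ Set.Icc (-27 / 50 : ℝ) (-1073 / 2000), 181 / 200 + 20 / 7 * (σ + 27 / 50) ≤ n →
      ∀ s ∈ Set.Icc (-27 / 50 : ℝ) σ,
      ∀ (ω : InfVolFermionState 2) (Ls : ℕ → ℕ) (ψ : ∀ L, Fock (Orb (FermionTorus 2 L))),
      Tendsto Ls atTop atTop →
      (∀ j, IsGroundStateInSector (hubbardTorusTT' (Ls j) 1 s (7 / 2)) (rectN n (Ls j)) 0 (ψ (Ls j))) →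
      (∀ j, star (ψ (Ls j)) ⬝ᵥ ψ (Ls j) = 1) → ω.IsTorusLimitOf ψ Ls →
      -(5166800 / 10000000 : ℝ) ≤ ((Finset.univ : Finset (DihedralGroup 4)).card : ℝ)⁻¹ * ∑ g ∈ (Finset.univ : Finset (DihedralGroup 4)),
        (ω.expect (d4ShiftSet g 0 (Literature.Probability.LatticeModels.box 2 7))
          (fermionEmbed (PolySite.d4Emb g 0 (Literature.Probability.LatticeModels.box 2 7)) (-oddMomentObsTT σ (7 / 2) 0))).re)
    (hL : ∀ n ∈ Set.Icc (181 / 200 : ℝ) (183 / 200), ∀ σ ∈ Set.Icc (-27 / 50 : ℝ) (-1073 / 2000), 181 / 200 + 20 / 7 * (σ + 27 / 50) ≤ n →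
      ∀ U' ∈ Set.Icc (7 / 2 : ℝ) (44 / 5),
      ∀ (ω : InfVolFermionState 2) (Ls : ℕ → ℕ) (ψ : ∀ L, Fock (Orb (FermionTorus 2 L))),
      Tendsto Ls atTop atTop →
      (∀ j, IsGroundStateInSector (hubbardTorusTT' (Ls j) 1 (-27 / 50) U') (rectN n (Ls j)) 0 (ψ (Ls j))) →
      (∀ j, star (ψ (Ls j)) ⬝ᵥ ψ (Ls j) = 1) → ω.IsTorusLimitOf ψ Ls →
      -(5166800 / 10000000 : ℝ) ≤ ((Finset.univ : Finset (DihedralGroup 4)).card : ℝ)⁻¹ * ∑ g ∈ (Finset.univ : Finset (DihedralGroup 4)),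
        (ω.expect (d4ShiftSet g 0 (Literature.Probability.LatticeModels.box 2 7))
          (fermionEmbed (PolySite.d4Emb g 0 (Literature.Probability.LatticeModels.box 2 7)) (-oddMomentObsTT σ U' 0))).re) :
    PatchBottom ∧ PatchLeftEdge :=
  ⟨covHg1201M19b_PatchBottom_of_fineTriangle hB, covHg1201M19b_PatchLeftEdge_of_fineTriangle hL⟩

end Summit.Ventures.CertifiedManyBodySolver.Theorems

end
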